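import Literature.NumberTheory.Automorphic.U3LocalBruhatDecompositionProofs
import Literature.NumberTheory.Automorphic.GLnIwahoriBorelFactorization
import Literature.NumberTheory.Automorphic.ParabolicInductionSupercuspidalProofs
import Literature.NumberTheory.Automorphic.UnitaryGroupOfFormAdelicTopology
import HarnessLib

/-!
# The Iwahori factorisation of the principal congruence subgroups of the quasi-split unitary group `U(σ, Φ_n)(K)`,
# its contracting torus elements, and their action on Jacquet modules
(Casselman, *Introduction to the theory of admissible representations of p-adic reductive groups* (1995), Prop. 1.4.4, proof of
Thm. 5.3.1; Bernstein–Zelevinsky (1976), §3.18–3.21; Rogawski (1990), §1.10 p. 9)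

Topic `NumberTheory/Automorphic`; namespace `Literature.NumberTheory.Automorphic.UnitaryGroup` (continues ★ `UnitaryGroupBorelInduction`
and ★ `U3LocalBruhatDecompositionProofs`).  THEOREMS ONLY (no definition, no named fact, no instance, no notation).  Cell
`pub/hodgecm-mathlib`, programme P2 (desk F0P2-plan, topic T7 «GR91 §5 local theta dichotomy»), row (a) «THE HARISH-CHANDRA NODE» = the in-house
pay-down of the ⇒ half of the printed citation ★ `Rogawski1990.u3_isSupercuspidal_iff_jacquet_eq_zero` (node N6 of `F0/P2/T7a-TREE.md` = node
N2′ of `F0/P3/T3b-TREE.md`); this file is the GROUP-THEORETIC half, the sequel `Rogawski1990/U3SupercuspidalJacquetVanishing` the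
representation-theoretic half.

Setting: `K` a field with a `ValuativeRel` (later a non-archimedean local field), `σ : K →+* K` any ring endomorphism, `J = Φ_n` the split
antidiagonal form (hypothesis `hJ : J = (StdForm.antidiagonal n).over K`, as in ★ `borelTriple`), `U = U(σ, Φ_n)(K) ≤ GL_n(K)`
(★ `unitaryGroupOfForm`), `K_γ = congruenceGL n γ` the principal congruence subgroups of `GL_n(K)` (★ `GLnCongruenceSubgroups`), `Θ_σ` the
quasi-split involution `g ↦ w⁰ ᵗ(σg)⁻¹ w⁰` of `GL_n(K)` whose fixed points are `U` (★ `qsInvolution`, ★ `mem_unitaryGroupOfForm_iff_qsInvolution_eq`).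

* §1 `coe_qsInvolution_apply`, `qsInvolution_mem_oppositeParabolicGL` (`Θ_σ` preserves the lower-triangular group `B_n⁻`, as it does `B_n`
  and `U_n`, ★ `qsInvolution_mem_borel`∕`_upperUnitriangular`), and **`exists_unitriangular_mul_lower_of_mem_unitary_congruenceGL`** — the
  IWAHORI FACTORISATION INSIDE `U`: for `γ < 1` every `k ∈ U ∩ K_γ` is `u b` with `u ∈ U ∩ U_n ∩ K_γ`, `b ∈ U ∩ B_n⁻ ∩ K_γ` (factor in `GL_n`
  by ★ `exists_unitriangular_mul_lower_of_mem_congruenceGL'`; `k = Θ_σ k = Θ_σ u · Θ_σ b` is a second such factorisation, so uniqueness ★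
  `unitriangular_mul_lower_unique` forces both factors to be `Θ_σ`-fixed, i.e. unitary).
* §2 `zpowDiagGL_mem_unitaryGroupOfForm_of_eq` (`ϖ^a ∈ U` for `σ ϖ = ϖ`, `a (rev i) + a i = 0`), `zpowDiagGL_inv_mul_mul_mem_congruenceGL`
  (CONTRACTION: `ϖ^{-a} (B_n⁻ ∩ K_γ) ϖ^{a} ⊆ K_γ` for antitone `a`), `exists_forall_zpowDiagGL_not_mem_mul_of_forall_eq_scalar` (ESCAPE: Rogawski's
  `d(ϖ^N, 1, ϖ^{-N})` leaves `C · Z` for every compact `C ⊆ GL₃(K)` and every set `Z` of scalars).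
* §3 `ParabolicTriple.subsingleton_coinvariants_of_comp` (vanishing of a Jacquet module transports along a homomorphism matching the
  radicals), and over a non-archimedean local field `K`, `n = 3`: `isCompact_isOpen_comap_congruenceGL` (`K_γ ∩ U` is compact open for
  continuous `σ`), **`coinvariants_mk_apply_apply_eq_of_mem_congruenceGL`** (the AVERAGING STEP `[ρ(k) ρ(a) w] = [ρ(a) w]` in `V_N` for
  `k ∈ K_γ ∩ U`, `a = ϖ^a` antitone, `w` fixed by `K_γ ∩ U`), `exists_torusU_family` (the family `a_N = d(ϖ^N, 1, ϖ^{-N}) ∈ M`),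
  `jacquetModule_pow_mk` (`(r_B a_1)^N [x] = [ρ(a_N) x]`).

HC_CM is proved only modulo the printed citations until rung 0 closes; nothing here bears on a summit statement.

## References
* [Casselman1995] W. Casselman, *Introduction to the theory of admissible representations of `p`-adic reductive groups* (1995 notes),
  Prop. 1.4.4 (Iwahori factorisation), Thm. 5.3.1 and its proof.
* [BernsteinZelevinsky1976] I. N. Bernstein, A. V. Zelevinsky, *Representations of the group GL(n, F) where F is a non-archimedean local
  field*, Russian Math. Surveys 31:3 (1976), §3.18–3.21.
* [BernsteinZelevinsky1977] I. N. Bernstein, A. V. Zelevinsky, *Induced representations of reductive p-adic groups I*, Ann. Sci. ÉNS 10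
  (1977), §1.8.
* [Rogawski1990] J. D. Rogawski, *Automorphic Representations of Unitary Groups in Three Variables*, Ann. of Math. Stud. 123 (1990),
  §1.9–§1.10 pp. 8–9 (the groups `B`, `M`, `N` of `U(3)`), §12.2 p. 173.
* [BruhatTits1972] F. Bruhat, J. Tits, *Groupes réductifs sur un corps local I*, Publ. Math. IHÉS 41 (1972), (4.4.3).
-/

set_option autoImplicit false

open scoped MatrixGroups Pointwise Topology
open ValuativeRel Matrix

namespace Literature.NumberTheory.Automorphic

namespace UnitaryGroup

/-! ## §1 The quasi-split involution preserves the lower-triangular group and the principal congruence subgroups;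
the Iwahori factorisation of `K_γ ∩ U(σ, Φ_n)` -/

section Theta

variable {K : Type*} [Field K] (σ : K →+* K) {n : ℕ}

/-- `(w⁰ M w⁰) i j = M (rev i) (rev j)` (private copy of ★ `weylLong_conj_apply` of `BigBruhatCellChart`, to keep the import
closure light). [folklore] -/
private theorem weylLong_conj_apply' (M : Matrix (Fin n) (Fin n) K) (i j : Fin n) :
    (((weylLong n K : GL (Fin n) K) : Matrix (Fin n) (Fin n) K) * M *
      ((weylLong n K : GL (Fin n) K) : Matrix (Fin n) (Fin n) K)) i j = M i.rev j.rev := by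
  have h1 : (((weylLong n K : GL (Fin n) K) : Matrix (Fin n) (Fin n) K) * M) = fun i j => M i.rev j := by
    rw [coe_weylLong, Equiv.Perm.permMatrix, PEquiv.toMatrix_toPEquiv_mul]; rfl
  have h2 : ∀ M' : Matrix (Fin n) (Fin n) K, M' * ((weylLong n K : GL (Fin n) K) : Matrix (Fin n) (Fin n) K) =
      fun i j => M' i j.rev := by
    intro M'
    rw [coe_weylLong, Equiv.Perm.permMatrix, PEquiv.mul_toMatrix_toPEquiv]; rfl
  rw [h2, h1]

/-- Entries of `Θ_σ(g) = w⁰ ᵗ(σg)⁻¹ w⁰`: `Θ_σ(g) i j = σ ((g⁻¹) (rev j) (rev i))`. [cite: Rogawski1990, §1.9–§1.10 pp. 8–9] -/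
theorem coe_qsInvolution_apply (g : GL (Fin n) K) (i j : Fin n) :
    ((qsInvolution σ g : GL (Fin n) K) : Matrix (Fin n) (Fin n) K) i j =
      σ (((g⁻¹ : GL (Fin n) K) : Matrix (Fin n) (Fin n) K) j.rev i.rev) := by
  rw [coe_qsInvolution, weylLong_conj_apply', Matrix.transpose_apply]
  have h : (((g : GL (Fin n) K) : Matrix (Fin n) (Fin n) K).map σ)⁻¹ =
      (((g⁻¹ : GL (Fin n) K) : Matrix (Fin n) (Fin n) K)).map σ := by
    rw [Matrix.coe_units_inv]
    exact Matrix.inv_eq_right_inv (Matrix.GeneralLinearGroup.coe_map_mul_map_inv σ g)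
  rw [h, Matrix.map_apply]

/-- **`Θ_σ(B⁻) ⊆ B⁻`**: the quasi-split involution preserves the lower-triangular group (entry `(i, j)`, `i < j`, of
`Θ_σ(b)` is `σ` of the entry `(rev j, rev i)` of `b⁻¹`, and `rev j < rev i`). [cite: Rogawski1990, §1.9–§1.10 pp. 8–9] -/
theorem qsInvolution_mem_oppositeParabolicGL {b : GL (Fin n) K} (hb : b ∈ oppositeParabolicGL K (_root_.id : Fin n → Fin n)) :
    qsInvolution σ b ∈ oppositeParabolicGL K (_root_.id : Fin n → Fin n) := by
  rw [mem_oppositeParabolicGL_iff] at hb ⊢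
  intro i j hij
  have hb' := (mem_oppositeParabolicGL_iff _).1 (Subgroup.inv_mem _ ((mem_oppositeParabolicGL_iff _).2 hb))
  rw [coe_qsInvolution_apply, hb' j.rev i.rev (by simpa using Fin.rev_lt_rev.2 hij), map_zero]

end Theta

section ThetaValued

variable {K : Type*} [Field K] [ValuativeRel K] (σ : K →+* K) {n : ℕ}

/-- **The Iwahori factorisation inside `U(σ, Φ_n)`.**  For `γ < 1` every `k ∈ U(σ, Φ_n) ∩ K_γ` is `u · b` with
`u ∈ U(σ, Φ_n) ∩ U_n ∩ K_γ` upper unitriangular and `b ∈ U(σ, Φ_n) ∩ B_n⁻ ∩ K_γ` lower triangular: factor `k = u b` in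
`GL_n` (★ `exists_unitriangular_mul_lower_of_mem_congruenceGL'`); since `k = Θ_σ k = Θ_σ u · Θ_σ b` is a second such
factorisation (Θ_σ preserves `U_n`, `B_n⁻`), uniqueness (★ `unitriangular_mul_lower_unique`) gives `Θ_σ u = u`, `Θ_σ b = b`,
i.e. both factors are unitary (★ `mem_unitaryGroupOfForm_iff_qsInvolution_eq`) — Casselman's Iwahori factorisation for the
quasi-split group. [cite: Casselman1995, Prop. 1.4.4] [cite: Rogawski1990, §1.10 p. 9] -/
theorem exists_unitriangular_mul_lower_of_mem_unitary_congruenceGL {γ : ValueGroupWithZero K} (hγ : γ < 1)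
    {J : Matrix (Fin n) (Fin n) K} (hJ : J = (StdForm.antidiagonal n).over K)
    {k : GL (Fin n) K} (hkU : k ∈ unitaryGroupOfForm σ J) (hk : k ∈ congruenceGL n γ) :
    ∃ u b : GL (Fin n) K, u ∈ unitaryGroupOfForm σ J ∧ b ∈ unitaryGroupOfForm σ J ∧
      u ∈ upperUnitriangular (Fin n) K ∧ b ∈ oppositeParabolicGL K (_root_.id : Fin n → Fin n) ∧
      u ∈ congruenceGL n γ ∧ b ∈ congruenceGL n γ ∧ k = u * b := by
  obtain ⟨u, b, hu, hb, huK, hbK, rfl⟩ := exists_unitriangular_mul_lower_of_mem_congruenceGL' hγ hk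
  have hJw : J = ((weylLong n K : GL (Fin n) K) : Matrix (Fin n) (Fin n) K) := by
    rw [hJ, antidiagonal_over_eq_coe_weylLong]
  subst hJw
  have hfix := (mem_unitaryGroupOfForm_iff_qsInvolution_eq σ (u * b)).1 hkU
  rw [qsInvolution_mul] at hfix
  obtain ⟨hu', hb'⟩ := unitriangular_mul_lower_unique (qsInvolution_mem_upperUnitriangular σ hu) hu
    (qsInvolution_mem_oppositeParabolicGL σ hb) hb hfix
  exact ⟨u, b, (mem_unitaryGroupOfForm_iff_qsInvolution_eq σ u).2 hu', (mem_unitaryGroupOfForm_iff_qsInvolution_eq σ b).2 hb',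
    hu, hb, huK, hbK, rfl⟩

end ThetaValued

/-! ## §2 Torus elements of `U(σ, Φ_n)`: unitarity, contraction of `K_γ ∩ B⁻`, escape from `C · Z` -/

section Torus

variable {K : Type*} [Field K] [ValuativeRel K] (σ : K →+* K) {n : ℕ} {ϖ : K} (hϖ : ϖ ≠ 0)

omit [ValuativeRel K] in
/-- **The torus elements `ϖ^a` with `a (rev i) + a i = 0` are unitary** for the split form `Φ_n` once `σ ϖ = ϖ`
(`σ(ϖ^{a (rev i)}) · ϖ^{a i} = ϖ^{a (rev i) + a i} = 1`; for `n = 3`: `d(ϖ^N, 1, ϖ^{-N}) ∈ M`, Rogawski's diagonal torus) — the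
`hJ`-parametrised twin of ★ `HermitianLattice.zpowDiagGL_mem_unitaryGroupOfForm` (stated there over `Valued` fields for `J₀` itself; not
imported to keep this file's closure light). [cite: Rogawski1990, §1.10 p. 9] [cite: BruhatTits1972, (4.4.3)] -/
theorem zpowDiagGL_mem_unitaryGroupOfForm_of_eq (hσϖ : σ ϖ = ϖ) {J : Matrix (Fin n) (Fin n) K} (hJ : J = (StdForm.antidiagonal n).over K)
    {a : Fin n → ℤ} (ha : ∀ i, a (Fin.rev i) + a i = 0) : zpowDiagGL hϖ a ∈ unitaryGroupOfForm σ J := by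
  have heq : zpowDiagGL hϖ a = glDiagonal n K (fun i => Units.mk0 ϖ hϖ ^ a i) :=
    Units.ext (by
      rw [coe_zpowDiagGL, coe_glDiagonal]
      congr 1
      funext i
      simp)
  rw [hJ, heq, glDiagonal_mem_unitaryGroupOfForm_antidiagonal_iff]
  intro i
  have h1 : ((Units.mk0 ϖ hϖ ^ a (Fin.rev i) : Kˣ) : K) = ϖ ^ a (Fin.rev i) := by simp
  have h2 : ((Units.mk0 ϖ hϖ ^ a i : Kˣ) : K) = ϖ ^ a i := by simp
  rw [h1, h2, map_zpow₀, hσϖ, ← zpow_add₀ hϖ, ha, zpow_zero]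

/-- **Contraction**: for an ANTITONE exponent vector `a` and `b ∈ B⁻ ∩ K_γ` (`γ < 1`, `|ϖ| ≤ 1`), the conjugate
`ϖ^{-a} b ϖ^{a}` lies in `K_γ` — its `(i, j)` entry is `ϖ^{a_j - a_i} b_{ij}`, with `a_j - a_i ≥ 0` below the diagonal and
`b_{ij} = 0` above it (★ `mem_congruenceGL_of_valBound_sub_one`). [cite: Casselman1995, Prop. 1.4.4; proof of Thm. 5.3.1] -/
theorem zpowDiagGL_inv_mul_mul_mem_congruenceGL (hϖ1 : valuation K ϖ ≤ 1) {γ : ValueGroupWithZero K} (hγ : γ < 1)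
    {a : Fin n → ℤ} (ha : Antitone a) {b : GL (Fin n) K} (hb : b ∈ oppositeParabolicGL K (_root_.id : Fin n → Fin n))
    (hbK : b ∈ congruenceGL n γ) : (zpowDiagGL hϖ a)⁻¹ * b * zpowDiagGL hϖ a ∈ congruenceGL n γ := by
  refine mem_congruenceGL_of_valBound_sub_one hγ fun i j => ?_
  rw [coe_zpowDiagGL_inv_mul_mul_sub_one_apply, map_mul, map_zpow₀]
  rcases lt_or_ge i j with hij | hij
  · -- above the diagonal `b_{ij} = 0 = (b - 1)_{ij}`
    have h0 : ((b : Matrix (Fin n) (Fin n) K) - 1) i j = 0 := by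
      rw [Matrix.sub_apply, (mem_oppositeParabolicGL_iff _).1 hb i j hij, Matrix.one_apply_ne (ne_of_lt hij), sub_zero]
    rw [h0, map_zero, mul_zero]
    exact zero_le
  · -- on or below the diagonal the exponent is `≥ 0`
    have hexp : 0 ≤ a j - a i := sub_nonneg.2 (ha hij)
    have hle : valuation K ϖ ^ (a j - a i) ≤ 1 := by
      obtain ⟨m, hm⟩ := Int.eq_ofNat_of_zero_le hexp
      rw [hm, zpow_natCast]
      exact pow_le_one' hϖ1 m
    calc valuation K ϖ ^ (a j - a i) * valuation K (((b : Matrix (Fin n) (Fin n) K) - 1) i j)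
        ≤ 1 * γ := mul_le_mul' hle (hbK.2.1 i j)
      _ = γ := one_mul γ

end Torus

section Escape

variable {K : Type*} [Field K] [ValuativeRel K] [TopologicalSpace K] [IsNonarchimedeanLocalField K]

/-- **The torus elements `d(ϖ^N, 1, ϖ^{-N})` eventually leave `C · Z`** for every compact `C ⊆ GL₃(K)` and the
subgroup `Z` of SCALAR matrices (hence for every subgroup of it): the continuous function `g ↦ (g⁻¹)₀₀ · g₂₂` is invariant
under right multiplication by scalars, bounded in valuation on `C`, and equals `ϖ^{-2N}` at `d(ϖ^N, 1, ϖ^{-N})` — the twin of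
★ `exists_forall_zpowDiagGL_not_mem_mul_center` for Rogawski's torus. [cite: Casselman1995, proof of Thm. 5.3.1]
[cite: BernsteinZelevinsky1976, §3.18–3.21] -/
theorem exists_forall_zpowDiagGL_not_mem_mul_of_forall_eq_scalar {ϖ : K} (hϖ0 : ϖ ≠ 0) (hϖ1 : valuation K ϖ < 1)
    {C : Set (GL (Fin 3) K)} (hC : IsCompact C) {Z : Set (GL (Fin 3) K)}
    (hZ : ∀ z ∈ Z, ∃ u : Kˣ, z = Matrix.GeneralLinearGroup.scalar (Fin 3) u) :
    ∃ N₀ : ℕ, ∀ N : ℕ, N₀ ≤ N →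
      zpowDiagGL hϖ0 (fun i : Fin 3 => (N : ℤ) * (1 - (i.val : ℤ))) ∉ C * Z := by
  set f : GL (Fin 3) K → K := fun g =>
    ((g⁻¹ : GL (Fin 3) K) : Matrix (Fin 3) (Fin 3) K) 0 0 * (g : Matrix (Fin 3) (Fin 3) K) 2 2 with hfdef
  have hf : Continuous f :=
    (Units.continuous_coe_inv.matrix_elem 0 0).mul (Units.continuous_val.matrix_elem 2 2)
  obtain ⟨γ, hγ⟩ := exists_forall_valuation_le_of_isCompact (hC.image hf)
  have hvϖ0 : valuation K ϖ ≠ 0 := (Valuation.ne_zero_iff _).2 hϖ0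
  obtain ⟨N₀, hN₀⟩ := exists_forall_lt_zpow_neg hvϖ0 hϖ1 γ
  refine ⟨N₀, fun N hN hmem => ?_⟩
  obtain ⟨g, hg, z, hz, hgz⟩ := Set.mem_mul.1 hmem
  obtain ⟨u, rfl⟩ := hZ z hz
  -- `f` is invariant under the scalars
  have hfz : f (g * Matrix.GeneralLinearGroup.scalar (Fin 3) u) = f g := by
    simp only [hfdef, _root_.mul_inv_rev, Units.val_mul, ← map_inv, Matrix.GeneralLinearGroup.coe_scalar,
      Matrix.scalar_apply, Matrix.diagonal_mul, Matrix.mul_diagonal]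
    rw [Units.val_inv_eq_inv_val]
    field_simp
  -- the value at the torus element
  have hft : f (zpowDiagGL hϖ0 (fun i : Fin 3 => (N : ℤ) * (1 - (i.val : ℤ)))) = ϖ ^ (-(N : ℤ)) * ϖ ^ (-(N : ℤ)) := by
    simp only [hfdef]
    rw [← zpowDiagGL_neg, coe_zpowDiagGL, coe_zpowDiagGL, Matrix.diagonal_apply_eq, Matrix.diagonal_apply_eq, Pi.neg_apply]
    norm_num
  have h1 : valuation K (f (zpowDiagGL hϖ0 (fun i : Fin 3 => (N : ℤ) * (1 - (i.val : ℤ))))) ≤ γ := by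
    rw [← hgz, hfz]
    exact hγ _ ⟨g, hg, rfl⟩
  rw [hft, map_mul, map_zpow₀] at h1
  have h2 : valuation K ϖ ^ (-(N : ℤ)) ≤ valuation K ϖ ^ (-(N : ℤ)) * valuation K ϖ ^ (-(N : ℤ)) := by
    have hge : 1 ≤ valuation K ϖ ^ (-(N : ℤ)) := by
      rw [_root_.zpow_neg, zpow_natCast]
      exact one_le_inv_iff₀.2 ⟨pow_pos (zero_lt_iff.2 hvϖ0) N, pow_le_one' hϖ1.le N⟩
    exact le_mul_of_one_le_right' hge
  exact absurd (h2.trans h1) (not_le.2 (hN₀ N hN))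

end Escape

/-! ## §3 Jacquet-module plumbing: transport of vanishing along a homomorphism matching the radicals -/

/-- **Vanishing of a Jacquet module transports along a homomorphism matching the radicals.**  For parabolic triples `t` of `G`
and `t′` of `G′`, a homomorphism `f : G′ → G` with `f(N′) ⊆ N` and a representation `ρ` of `G`: if the `N′`-coinvariants of
`ρ ∘ f` vanish then so do the `N`-coinvariants of `ρ` (every relation `ρ(f n′) z - z` is an `N`-relation; same underlying space).
[cite: BernsteinZelevinsky1977, §1.8] -/
theorem _root_.Literature.NumberTheory.Automorphic.ParabolicTriple.subsingleton_coinvariants_of_comp {G G' : Type*} [Group G] [Group G']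
    (t : ParabolicTriple G) (t' : ParabolicTriple G') {k W : Type*} [CommRing k] [AddCommGroup W] [Module k W]
    (f : G' →* G) (ρ : Representation k G W) (hN : ∀ n : G', n ∈ t'.N → f n ∈ t.N)
    (h : Subsingleton (t'.restrict (ρ.comp f)).Coinvariants) : Subsingleton (t.restrict ρ).Coinvariants := by
  have hle : Representation.Coinvariants.ker (t'.restrict (ρ.comp f)) ≤ Representation.Coinvariants.ker (t.restrict ρ) := by
    rw [Representation.Coinvariants.ker, Submodule.span_le]
    rintro _ ⟨⟨n, z⟩, rfl⟩
    have hn : ((n : ↥t'.P) : G') ∈ t'.N := Subgroup.mem_subgroupOf.1 n.2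
    exact Representation.Coinvariants.sub_mem_ker (ρ := t.restrict ρ) ⟨⟨f ((n : ↥t'.P) : G'), t.N_le (hN _ hn)⟩, hN _ hn⟩ z
  refine ⟨fun x x' => ?_⟩
  obtain ⟨a, rfl⟩ := Representation.Coinvariants.mk_surjective _ x
  obtain ⟨b, rfl⟩ := Representation.Coinvariants.mk_surjective _ x'
  rw [Representation.Coinvariants.mk_eq_iff]
  exact hle ((Representation.Coinvariants.mk_eq_iff _).1 (Subsingleton.elim _ _))

/-! ## §3b Over a non-archimedean local field, `n = 3`: the compact open `K_γ ∩ U`, the averaging step, Rogawski's torus family -/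

section Model

variable {K : Type*} [Field K] [ValuativeRel K] [TopologicalSpace K] [IsNonarchimedeanLocalField K]
  (σ : K →+* K) {J : Matrix (Fin 3) (Fin 3) K} (hJ : J = (StdForm.antidiagonal 3).over K)
  {V : Type*} [AddCommGroup V] [Module ℂ V]

/-- The trace `K_γ ∩ U` on `U = U(σ, J)` of a principal congruence subgroup is compact and open once `U` is closed in
`GL₃(K)` (closed embedding `U ↪ GL₃(K)`; ★ `isCompact_congruenceGL`, ★ `isOpen_congruenceGL`). [cite: Casselman1995, §1.4, Prop. 1.4.4]
[cite: PlatonovRapinchuk1994, §3.3] -/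
theorem isCompact_isOpen_comap_congruenceGL (hσc : Continuous σ) {γ : ValueGroupWithZero K} (hγ : γ ≠ 0) :
    IsCompact (((congruenceGL 3 γ).comap (unitaryGroupOfForm σ J).subtype : Subgroup ↥(unitaryGroupOfForm σ J)) :
        Set ↥(unitaryGroupOfForm σ J)) ∧
      IsOpen (((congruenceGL 3 γ).comap (unitaryGroupOfForm σ J).subtype : Subgroup ↥(unitaryGroupOfForm σ J)) :
        Set ↥(unitaryGroupOfForm σ J)) := by
  haveI : T2Space K := (Literature.NumberTheory.GaloisRepresentations.IsNonarchimedeanLocalField.isLocalField K).toT2Space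
  have hcl : IsClosed (unitaryGroupOfForm σ J : Set (GL (Fin 3) K)) := isClosed_unitaryGroupOfForm hσc J
  refine ⟨?_, ?_⟩
  · exact hcl.isClosedEmbedding_subtypeVal.isCompact_preimage (isCompact_congruenceGL γ)
  · exact (isOpen_congruenceGL hγ).preimage continuous_subtype_val

omit [TopologicalSpace K] [IsNonarchimedeanLocalField K] in
/-- **The averaging step.**  For `γ < 1`, an antitone exponent vector `a` with `t = ϖ^a ∈ U` (`|ϖ| ≤ 1`), a vector `w` fixed by
`K_γ ∩ U` and `k ∈ K_γ ∩ U`: `[ρ(k) ρ(t) w] = [ρ(t) w]` in the Jacquet module `V_N` — write `k = u b` (§1: `u ∈ N`, `b ∈ B⁻ ∩ K_γ ∩ U`),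
so `ρ(k)ρ(t)w = ρ(u) ρ(t) ρ(t⁻¹ b t) w = ρ(u) ρ(t) w` (§2: `t⁻¹ b t ∈ K_γ`) and `u` acts trivially on `V_N`.
[cite: Casselman1995, Thm. 5.3.1, Prop. 1.4.4] -/
theorem coinvariants_mk_apply_apply_eq_of_mem_congruenceGL {γ : ValueGroupWithZero K} (hγ : γ < 1)
    {ϖ : K} (hϖ0 : ϖ ≠ 0) (hϖ1 : valuation K ϖ ≤ 1) {a : Fin 3 → ℤ} (ha : Antitone a)
    (t : ↥(unitaryGroupOfForm σ J)) (ht : ((t : ↥(unitaryGroupOfForm σ J)) : GL (Fin 3) K) = zpowDiagGL hϖ0 a)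
    (ρ : Representation ℂ ↥(unitaryGroupOfForm σ J) V) {w : V}
    (hw : ∀ g ∈ (congruenceGL 3 γ).comap (unitaryGroupOfForm σ J).subtype, ρ g w = w)
    {k : ↥(unitaryGroupOfForm σ J)} (hk : k ∈ (congruenceGL 3 γ).comap (unitaryGroupOfForm σ J).subtype) :
    Representation.Coinvariants.mk ((borelTriple σ J hJ).restrict ρ) (ρ k (ρ t w)) =
      Representation.Coinvariants.mk ((borelTriple σ J hJ).restrict ρ) (ρ t w) := by
  have hkGL : (k : GL (Fin 3) K) ∈ congruenceGL 3 γ := hk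
  obtain ⟨u, b, huU, hbU, hu, hb, -, hbK, hkub⟩ := exists_unitriangular_mul_lower_of_mem_unitary_congruenceGL σ hγ hJ k.2 hkGL
  have hconjGL := zpowDiagGL_inv_mul_mul_mem_congruenceGL hϖ0 hϖ1 hγ ha hb hbK
  have hkeq : k = (⟨u, huU⟩ : ↥(unitaryGroupOfForm σ J)) * ⟨b, hbU⟩ := Subtype.ext hkub
  have hconj : t⁻¹ * (⟨b, hbU⟩ : ↥(unitaryGroupOfForm σ J)) * t ∈ (congruenceGL 3 γ).comap (unitaryGroupOfForm σ J).subtype := by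
    show ((t⁻¹ * (⟨b, hbU⟩ : ↥(unitaryGroupOfForm σ J)) * t : ↥(unitaryGroupOfForm σ J)) : GL (Fin 3) K) ∈ congruenceGL 3 γ
    rw [Subgroup.coe_mul, Subgroup.coe_mul, Subgroup.coe_inv, ht]
    exact hconjGL
  have huN : (⟨u, huU⟩ : ↥(unitaryGroupOfForm σ J)) ∈ (borelTriple σ J hJ).N := hu
  have h1 : ρ k (ρ t w) = ρ (⟨u, huU⟩ : ↥(unitaryGroupOfForm σ J)) (ρ t (ρ (t⁻¹ * (⟨b, hbU⟩ : ↥(unitaryGroupOfForm σ J)) * t) w)) := by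
    rw [hkeq, ← Module.End.mul_apply, ← MonoidHom.map_mul, ← Module.End.mul_apply, ← MonoidHom.map_mul, ← Module.End.mul_apply,
      ← MonoidHom.map_mul]
    congr 1
    group
  rw [h1, hw _ hconj]
  exact Representation.Coinvariants.mk_self_apply ((borelTriple σ J hJ).restrict ρ)
    ⟨⟨(⟨u, huU⟩ : ↥(unitaryGroupOfForm σ J)), (borelTriple σ J hJ).N_le huN⟩, huN⟩ _

omit [ValuativeRel K] [TopologicalSpace K] [IsNonarchimedeanLocalField K] in
/-- **Rogawski's torus elements `a_N = d(ϖ^N, 1, ϖ^{-N}) ∈ M ≤ U(σ, Φ₃)`** for a `σ`-fixed `ϖ ≠ 0`, as a multiplicative family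
`a_{N+1} = a_N a_1`, `a_0 = 1` (exponent vector `i ↦ N(1 - i)`, antitone and antisymmetric under `i ↦ 2 - i`).
[cite: Rogawski1990, §1.10 p. 9] -/
theorem exists_torusU_family {ϖ : K} (hϖ0 : ϖ ≠ 0) (hσϖ : σ ϖ = ϖ) :
    ∃ a : ℕ → ↥(unitaryGroupOfForm σ J),
      (∀ N, ((a N : ↥(unitaryGroupOfForm σ J)) : GL (Fin 3) K) = zpowDiagGL hϖ0 (fun i : Fin 3 => (N : ℤ) * (1 - (i.val : ℤ)))) ∧
      (∀ N, a (N + 1) = a N * a 1) ∧ a 0 = 1 ∧ (∀ N, a N ∈ (borelTriple σ J hJ).M) ∧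
      ∀ N : ℕ, Antitone (fun i : Fin 3 => (N : ℤ) * (1 - (i.val : ℤ))) := by
  have haE_rev : ∀ (N : ℕ) (i : Fin 3), (N : ℤ) * (1 - ((Fin.rev i).val : ℤ)) + (N : ℤ) * (1 - (i.val : ℤ)) = 0 := by
    intro N i
    have h2 : ((Fin.rev i).val : ℤ) + (i.val : ℤ) = 2 := by
      have h := Fin.val_rev i
      have hi := i.isLt
      omega
    linear_combination (-(N : ℤ)) * h2
  have haE_anti : ∀ N : ℕ, Antitone (fun i : Fin 3 => (N : ℤ) * (1 - (i.val : ℤ))) := by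
    intro N i j hij
    have h2 : (i.val : ℤ) ≤ (j.val : ℤ) := by exact_mod_cast hij
    have hN : (0 : ℤ) ≤ N := Int.natCast_nonneg N
    show (N : ℤ) * (1 - (j.val : ℤ)) ≤ (N : ℤ) * (1 - (i.val : ℤ))
    nlinarith
  have haU : ∀ N : ℕ, zpowDiagGL hϖ0 (fun i : Fin 3 => (N : ℤ) * (1 - (i.val : ℤ))) ∈ unitaryGroupOfForm σ J := fun N =>
    zpowDiagGL_mem_unitaryGroupOfForm_of_eq σ hϖ0 hσϖ hJ (haE_rev N)
  refine ⟨fun N => ⟨_, haU N⟩, fun N => rfl, fun N => ?_, ?_, fun N => ?_, haE_anti⟩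
  · apply Subtype.ext
    rw [Subgroup.coe_mul]
    show zpowDiagGL hϖ0 _ = zpowDiagGL hϖ0 _ * zpowDiagGL hϖ0 _
    rw [← zpowDiagGL_add]
    congr 1
    funext i
    simp only [Pi.add_apply]
    push_cast
    ring
  · apply Subtype.ext
    rw [Subgroup.coe_one]
    show zpowDiagGL hϖ0 _ = 1
    have h0 : (fun i : Fin 3 => ((0 : ℕ) : ℤ) * (1 - (i.val : ℤ))) = 0 := by funext i; simp
    rw [h0, zpowDiagGL_zero]
  · rw [borelTriple_M, mem_torusU_iff]
    refine ⟨fun i => Units.mk0 ϖ hϖ0 ^ ((N : ℤ) * (1 - (i.val : ℤ))), Units.ext ?_⟩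
    rw [coe_glDiagonal]
    show (Matrix.diagonal fun i => (((Units.mk0 ϖ hϖ0 ^ ((N : ℤ) * (1 - (i.val : ℤ))) : Kˣ)) : K)) =
      ((zpowDiagGL hϖ0 (fun i : Fin 3 => (N : ℤ) * (1 - (i.val : ℤ))) : GL (Fin 3) K) : Matrix (Fin 3) (Fin 3) K)
    rw [coe_zpowDiagGL]
    congr 1
    funext i
    simp

omit [ValuativeRel K] [TopologicalSpace K] [IsNonarchimedeanLocalField K] in
/-- **Iterating the torus action on the Jacquet module**: for a multiplicative family `a` in `M` (`a_{N+1} = a_N a_1`, `a_0 = 1`),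
`(r_B(a_1))^N [x] = [ρ(a_N) x]` (★ `Representation.jacquetModule_mk`). [cite: BernsteinZelevinsky1977, §1.8] -/
theorem jacquetModule_pow_mk {a : ℕ → ↥(unitaryGroupOfForm σ J)} (ha_succ : ∀ N, a (N + 1) = a N * a 1) (ha_zero : a 0 = 1)
    (haM : ∀ N, a N ∈ (borelTriple σ J hJ).M) (ρ : Representation ℂ ↥(unitaryGroupOfForm σ J) V) (N : ℕ) (x : V) :
    (ρ.jacquetModule (borelTriple σ J hJ) ⟨a 1, haM 1⟩ ^ N) (Representation.Coinvariants.mk ((borelTriple σ J hJ).restrict ρ) x) =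
      Representation.Coinvariants.mk ((borelTriple σ J hJ).restrict ρ) (ρ (a N) x) := by
  induction N generalizing x with
  | zero => rw [pow_zero, Module.End.one_apply, ha_zero, MonoidHom.map_one, Module.End.one_apply]
  | succ N ih =>
    rw [pow_succ, Module.End.mul_apply]
    have h1 : ρ.jacquetModule (borelTriple σ J hJ) ⟨a 1, haM 1⟩ (Representation.Coinvariants.mk ((borelTriple σ J hJ).restrict ρ) x) =
        Representation.Coinvariants.mk ((borelTriple σ J hJ).restrict ρ) (ρ (a 1) x) :=
      Representation.jacquetModule_mk ρ (borelTriple σ J hJ) ⟨a 1, haM 1⟩ x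
    have h2 : ρ (a N) (ρ (a 1) x) = ρ (a (N + 1)) x := by
      rw [ha_succ N, MonoidHom.map_mul, Module.End.mul_apply]
    rw [h1, ih, h2]

end Model

end UnitaryGroup

end Literature.NumberTheory.Automorphic
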